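import Literature.Probability.RandomPlanarGeometry.SLEBubblesAvoidance
import Literature.Probability.RandomPlanarGeometry.SLEBubblesRealLine
import Literature.Probability.RandomPlanarGeometry.SLERestrictionSlidHull
import Literature.Probability.RandomPlanarGeometry.StarHullOneStep
import Literature.Probability.RandomPlanarGeometry.LoewnerBoundaryExtension
import Literature.Probability.RandomPlanarGeometry.RestrictionHullsHolds
import HarnessLib

/-!
# (7.2) for the slid hulls: the bubble hitting mass `−Sh_t(W_t)/6`, and [LSW] Theorem 7.3's analytic input reduced to Theorem 6.5 as printed

Proof companion (one definition, no named fact) of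
`Literature.Probability.RandomPlanarGeometry.SLEBubblesAvoidance` ([LSW] Thm. 7.3, avoidance
formula (7.3)), after

* G. F. Lawler, O. Schramm, W. Werner, *Conformal restriction: the chordal case*, J. Amer. Math.
  Soc. **16** (2003) 917–955, arXiv:math/0209343 (**[LSW]**), §5 (the Schwarzian
  `Sf = f‴/f′ − (3/2)(f″/f′)²`, eq. (5.1) `S g_A(0) = −6 a({−1/z : z ∈ A})`, (5.2)–(5.3)
  `α = (6 − κ)/(2κ)`, `λ = (8 − 3κ)(6 − κ)/(2κ)`, Prop. 5.3: "then
  `Y_t = h_t′(W_t)^α exp(λ ∫₀ᵗ Sh_s(W_s)/6 ds)`, `t < T`, is a local martingale. If `κ ≤ 8/3`,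
  then `Y_t` is a bounded martingale"), §6 **Theorem 6.5**: "Suppose `0 ≤ κ ≤ 8/3` and let `α`
  and `λ` be as in (5.2) and (5.3). If `W_t = √κ B_t` and `A ∈ 𝒬*`, then
  `Φ_A′(0)^α = E[1_{γ[0,∞) ∩ A = ∅} exp(λ ∫₀^∞ Sh_s(W_s)/6 ds)]`", and §7.2 (pp. 28–29, proof of
  (7.3)): "By (7.2), for any `t > 0` on the event `γ[0, t] ∩ A = ∅`,
  `P[{K : g_t⁻¹(K + W_t) ∩ A ≠ ∅} | g_t] = P[{K : (K + W_t) ∩ g_t(A) ≠ ∅} | g_t] = −Sh_t(W_t)/6`".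

The named fact `SLEBubbles.lintegral_poissonAvoidance_eq_rpow` (`SLEBubblesAvoidance`) is
Theorem 6.5 READ THROUGH (7.2): its integrand is written with the masses
`μ{K : g_t⁻¹(K + W_t) ∩ A ≠ ∅}` of an arbitrary Brownian bubble measure `μ` (a measure on `Ω_b`
with the hitting masses (7.2), `IsBrownianBubbleMeasure`). This file PROVES the sentence of §7.2
quoted above — the identification of these masses with the Schwarzian term — and thereby reduces
the fact to Theorem 6.5 exactly as printed, a statement about the SLE_κ flow alone in which no
bubble measure appears:

* `Literature.Probability.RandomPlanarGeometry.norm_hullExt_sub_taylor_le`,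
  `…hasRestrictionJet_hullExt`, `…hasRestrictionJet_starRMap` — the third-order Taylor expansion
  at `0` of the reflected extension `E_B` of `Φ_B` (quantitative: remainder `≤ (8/ρ₀³)|z|⁴` on
  `|z| ≤ ρ₀/4` if `B` misses `B(0, 8ρ₀)`), so that every `*`-hull has the jet
  `(Φ_B′(0), E_B″(0)/2, E_B‴(0)/6)` in the sense of `HasRestrictionJet` (`BrownianBubbles`), with
  the canonical real jets `starDeriv`, `starJet2`, `starJet3` of `StarHullCanonical`/`StarHullOneStep`;
* `Literature.Probability.RandomPlanarGeometry.starBubbleMass B = E_B″(0)²/(4 Φ_B′(0)²) − E_B‴(0)/(6 Φ_B′(0))`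
  — the number `−SΦ_B(0)/6` of (7.2) for the canonical map, and
  `IsBrownianBubbleMeasure.measure_hit_eq_starBubbleMass`: **`μ{K : K ∩ B ≠ ∅} = −SΦ_B(0)/6`** for
  every Brownian bubble measure `μ` and every `B ∈ 𝒬*`;
* `Literature.Probability.RandomPlanarGeometry.bubbleHitFibre_eq_hit_slidHull` — **the first
  equality of the display**: `{K : g_t⁻¹(K + W_t) ∩ A ≠ ∅} = {K : K ∩ (g_t(A) − W_t) ≠ ∅}` as
  soon as no point of `A` is swallowed by time `t` (bubbles lie in the open half-plane, real
  points of `A` are mapped to real points), in particular for every `t` when the chain is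
  generated by a simple curve missing `A` (`bubbleHitFibre_eq_hit_slidHull_of_disjoint`); hence
  (`IsBrownianBubbleMeasure.measure_bubbleHitFibre_eq`) **`μ{K : g_t⁻¹(K + W_t) ∩ A ≠ ∅} =
  −Sh_t(W_t)/6`**, `h_t` being the canonical map of the slid hull `A_t − W_t ∈ 𝒬*`
  (`Loewner.IsGeneratedByCurve.isStarHull_slidHull`);
* `Literature.Probability.RandomPlanarGeometry.SLEBubbles.lintegral_poissonAvoidance_eq_rpow_of_thm65`
  — **the named fact from Theorem 6.5 as printed**: if for `0 < κ ≤ 8/3` and `A ∈ 𝒬*` with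
  `Φ_A′(0) = d`,
  `E[1_{γ ∩ A = ∅} exp(−λ_κ ∫₀^∞ (−Sh_t(W_t)/6) dt)] = d^{α_κ}` (with `exp(−∞) = 0`,
  `poissonAvoidance`), then `SLEBubbles.lintegral_poissonAvoidance_eq_rpow` holds — for
  `preWienerMeasure`-a.e. sample the SLE_κ trace is a simple curve (Rohde–Schramm,
  `SLEBubbles.ae_isSimpleTrace_sleTrace`), so on `{γ ∩ A = ∅}` the two integrands agree for
  every `t`;
* `Literature.Probability.RandomPlanarGeometry.driftCoeffK`, `driftCoeffK_sleBubbleExponent` —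
  the computation behind Prop. 5.3 in the form consumed by the tree's conditional-increment
  method (`StarHullOneStep.driftCoeff` is its case `α = 5/8`, `driftCoeffK_five_eighths`): per unit
  time, the drift of `h_t′(W_t)^α` under the one-step expansion of `StarHullOneStep`
  (`E x = 0`, `E x² = κ u`) is `α d^{α−1}[(κ/2 − 4/3) c₃ + c₂²/(2d)] + ½ α(α − 1) d^{α−2} κ c₂²`
  (`c₂ = E″(0)`, `c₃ = E‴(0)`), and **for `α = α_κ` it equals `λ_κ · (−SΦ(0)/6) · d^α`**, so that
  `h_t′(W_t)^α exp(λ ∫₀ᵗ Sh_s(W_s)/6 ds)` is driftless — [LSW] (5.3)/Prop. 5.3, PROVED as an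
  identity of rational functions.

* sanity checks of the printed form (all PROVED): it holds at `A = ∅` for every `κ`
  (`SLEBubbles.thm65_schwarzian_empty`; `starMap ∅ = id`, `starBubbleMass ∅ = 0`), and **at
  `κ = 8/3` it is [LSW] Theorem 6.1**, discharged in the tree (`SLEBubbles.thm65_schwarzian_eight_thirds`
  from `sle_restriction_eightThirds_holds`: `λ_{8/3} = 0`, `α_{8/3} = 5/8`).

What remains of the named fact after this file is Theorem 6.5 itself for `0 < κ < 8/3` (the
martingale property of `Y_t` along the SLE_κ flow and the identification of its terminal value,
[LSW] Prop. 5.3 with Lemmas 6.2–6.3), the tree's proof (`SLERestriction*`) covering `κ = 8/3`.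

## References

* [LSW] §5 (5.1)–(5.3), Prop. 5.3; §6 Thm. 6.5; §7.1 (7.2); §7.2 pp. 28–29.
  [LawlerSchrammWerner2003Restriction]
* G. F. Lawler, *Conformally Invariant Processes in the Plane*, AMS (2005), §4.6.1 (4.37),
  Prop. 5.22. [Lawler2005]
-/

noncomputable section

open Set Filter Topology MeasureTheory Metric Complex
open UpperHalfPlane (upperHalfPlaneSet)
open scoped NNReal ENNReal
open Literature.Probability.Process (preWienerMeasure)

namespace Literature.Probability.RandomPlanarGeometry

open Loewner

/-! ### The third-order Taylor expansion of `E_B` at `0` and the jet of `Φ_B` -/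

section Taylor

variable {B : Set ℂ} {Φ : ConformalEquiv (upperHalfPlaneSet \ B) upperHalfPlaneSet} {d ρ₀ : ℝ}
variable (hB : IsStarHull B) (hΦ : IsRestrictionMap B Φ) (hd : HasRestrictionDeriv B Φ d)
  (hρ₀ : 0 < ρ₀) (hBρ : Disjoint (ball (0 : ℂ) (8 * ρ₀)) B)

include hB hΦ hd hρ₀ hBρ in
/-- **Third-order Taylor expansion of `E_B` at `0`, with remainder**: for `‖z‖ ≤ ρ₀/4`,
`‖E_B(z) − (d z + E_B″(0) z²/2 + E_B‴(0) z³/6)‖ ≤ (8/ρ₀³) ‖z‖⁴` (`E_B(0) = 0`, `E_B′(0) = d`; the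
second-order expansion of `E_B′`, `Loewner.norm_deriv_hullExt_sub_taylor_le`, integrated along
`[0, z]`). [folklore] -/
theorem norm_hullExt_sub_taylor_le {z : ℂ} (hz : ‖z‖ ≤ ρ₀ / 4) :
    ‖hullExt Φ z - (d * z + deriv (deriv (hullExt Φ)) 0 / 2 * z ^ 2 +
        deriv (deriv (deriv (hullExt Φ))) 0 / 6 * z ^ 3)‖ ≤ 8 / ρ₀ ^ 3 * ‖z‖ ^ 4 := by
  obtain ⟨-, hE, -⟩ := differentiableOn_hmap hB hΦ hρ₀ hBρ
  set E := hullExt Φ with hEdef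
  set c₂ := deriv (deriv E) 0 with hc₂
  set c₃ := deriv (deriv (deriv E)) 0 with hc₃
  set s : Set ℂ := closedBall (0 : ℂ) ‖z‖ with hs
  have hsconv : Convex ℝ s := convex_closedBall _ _
  have h0s : (0 : ℂ) ∈ s := mem_closedBall_self (norm_nonneg _)
  have hzs : z ∈ s := mem_closedBall_zero_iff.2 le_rfl
  have hsball : s ⊆ ball (0 : ℂ) (4 * ρ₀) :=
    closedBall_subset_ball (by linarith [norm_nonneg z])
  -- the polynomial-corrected function and its derivative
  have hP : ∀ y ∈ s, HasDerivAt (fun y ↦ E y - (d * y + c₂ / 2 * y ^ 2 + c₃ / 6 * y ^ 3))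
      (deriv E y - d - c₂ * y - c₃ * y ^ 2 / 2) y := by
    intro y hy
    have hEy : HasDerivAt E (deriv E y) y :=
      ((hE y (hsball hy)).differentiableAt (isOpen_ball.mem_nhds (hsball hy))).hasDerivAt
    have := hEy.sub ((((hasDerivAt_id y).const_mul (d : ℂ)).add
      (((hasDerivAt_id y).pow 2).const_mul (c₂ / 2))).add (((hasDerivAt_id y).pow 3).const_mul (c₃ / 6)))
    refine this.congr_deriv ?_
    simp only [id_eq, mul_one, Nat.cast_ofNat]
    ring
  have hbound : ∀ y ∈ s, ‖deriv E y - d - c₂ * y - c₃ * y ^ 2 / 2‖ ≤ 8 / ρ₀ ^ 3 * ‖z‖ ^ 3 := by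
    intro y hy
    have hy' : ‖y‖ ≤ ‖z‖ := mem_closedBall_zero_iff.1 hy
    have h := norm_deriv_hullExt_sub_taylor_le hB hΦ hd hρ₀ hBρ (hy'.trans hz)
    calc ‖deriv E y - d - c₂ * y - c₃ * y ^ 2 / 2‖ ≤ 8 / ρ₀ ^ 3 * ‖y‖ ^ 3 := h
      _ ≤ 8 / ρ₀ ^ 3 * ‖z‖ ^ 3 := by gcongr
  have h := hsconv.norm_image_sub_le_of_norm_deriv_le (fun y hy ↦ (hP y hy).differentiableAt)
    (fun y hy ↦ by rw [(hP y hy).deriv]; exact hbound y hy) h0s hzs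
  have hE0 : E 0 = 0 := hullExt_zero hB hΦ
  simp only [hE0, mul_zero, ne_eq, OfNat.ofNat_ne_zero, not_false_eq_true, zero_pow, add_zero,
    sub_zero, sub_self] at h
  calc _ ≤ 8 / ρ₀ ^ 3 * ‖z‖ ^ 3 * ‖z‖ := by simpa using h
    _ = 8 / ρ₀ ^ 3 * ‖z‖ ^ 4 := by ring

include hB hΦ hd hρ₀ hBρ in
/-- **The jet of `Φ_B` at `0`**: `Φ_B(z) = d z + (E_B″(0)/2) z² + (E_B‴(0)/6) z³ + o(z³)` inside
`ℍ ∖ B`, with the REAL coefficients `E_B″(0)/2`, `E_B‴(0)/6` (`E_B` is real on the real axis,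
`Loewner.im_iteratedDeriv_hullExt_ofReal`; `E_B = Φ_B` on `ℍ ∖ B`). [cite: Lawler2005, proof of Prop. 5.22 (§5.5)] -/
theorem hasRestrictionJet_hullExt :
    HasRestrictionJet B Φ d ((deriv (deriv (hullExt Φ)) 0).re / 2)
      ((deriv (deriv (deriv (hullExt Φ))) 0).re / 6) := by
  obtain ⟨-, h2, h3⟩ := im_iteratedDeriv_hullExt_ofReal hB hΦ hρ₀ hBρ (x := 0)
    (by rw [abs_zero]; positivity)
  rw [ofReal_zero] at h2 h3
  set c₂ := deriv (deriv (hullExt Φ)) 0 with hc₂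
  set c₃ := deriv (deriv (deriv (hullExt Φ))) 0 with hc₃
  have e2 : (((c₂.re / 2 : ℝ)) : ℂ) = c₂ / 2 := by
    have : (c₂.re : ℂ) = c₂ := Complex.ext (by simp) (by simp [h2])
    rw [ofReal_div, this]
    norm_num
  have e3 : (((c₃.re / 6 : ℝ)) : ℂ) = c₃ / 6 := by
    have : (c₃.re : ℂ) = c₃ := Complex.ext (by simp) (by simp [h3])
    rw [ofReal_div, this]
    norm_num
  unfold HasRestrictionJet
  rw [e2, e3]
  have hball : ∀ᶠ z in 𝓝[upperHalfPlaneSet \ B] (0 : ℂ), ‖z‖ ≤ ρ₀ / 4 := by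
    have : closedBall (0 : ℂ) (ρ₀ / 4) ∈ 𝓝 (0 : ℂ) := closedBall_mem_nhds _ (by positivity)
    filter_upwards [mem_nhdsWithin_of_mem_nhds this] with z hz
    exact mem_closedBall_zero_iff.1 hz
  have hev : ∀ᶠ z in 𝓝[upperHalfPlaneSet \ B] (0 : ℂ),
      ‖(Φ z - (d * z + c₂ / 2 * z ^ 2 + c₃ / 6 * z ^ 3)) / z ^ 3‖ ≤ 8 / ρ₀ ^ 3 * ‖z‖ := by
    filter_upwards [hball, self_mem_nhdsWithin] with z hz hzmem
    have hz0 : z ≠ 0 := by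
      rintro rfl
      exact absurd hzmem.1 (by simp [upperHalfPlaneSet])
    rw [← hullExt_of_mem_diff hzmem, norm_div, norm_pow, div_le_iff₀ (by positivity)]
    calc ‖hullExt Φ z - (d * z + c₂ / 2 * z ^ 2 + c₃ / 6 * z ^ 3)‖ ≤ 8 / ρ₀ ^ 3 * ‖z‖ ^ 4 :=
          norm_hullExt_sub_taylor_le hB hΦ hd hρ₀ hBρ hz
      _ = 8 / ρ₀ ^ 3 * ‖z‖ * ‖z‖ ^ 3 := by ring
  refine squeeze_zero_norm' hev ?_
  have : Tendsto (fun z : ℂ ↦ 8 / ρ₀ ^ 3 * ‖z‖) (𝓝 0) (𝓝 (8 / ρ₀ ^ 3 * ‖(0 : ℂ)‖)) :=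
    (continuous_const.mul continuous_norm).tendsto 0
  simpa using this.mono_left nhdsWithin_le_nhds

end Taylor

/-! ### The bubble hitting mass `−SΦ_B(0)/6` of a `*`-hull ([LSW] (7.2)) -/

/-- **`−SΦ_B(0)/6` for the canonical map of a `*`-hull** ([LSW] (7.2) with §5:
`Sf = f‴/f′ − (3/2)(f″/f′)²`): the right-hand side `bubbleMass d c₂ c₃ = c₂²/d² − c₃/d` of (7.2)
(`BrownianBubbles`) at the canonical jet `d = Φ_B′(0) = starDeriv B`, `c₂ = E_B″(0)/2 = starJet2 B/2`,
`c₃ = E_B‴(0)/6 = starJet3 B/6` of the reflected extension `E_B = starMap B`; explicitly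
`E_B″(0)²/(4d²) − E_B‴(0)/(6d) = −SE_B(0)/6` (`starBubbleMass_eq`). Along the SLE flow,
`starBubbleMass (A_t − W_t) = −Sh_t(W_t)/6`. (Junk value off `𝒬*`, where the canonical data are
junk.) [cite: LawlerSchrammWerner2003Restriction, §7.1 eq. (7.2) (p. 28) with §5 (Schwarzian)] -/
def starBubbleMass (B : Set ℂ) : ℝ :=
  bubbleMass (starDeriv B) (starJet2 B / 2) (starJet3 B / 6)

/-- `starBubbleMass B = E_B″(0)²/(4 Φ_B′(0)²) − E_B‴(0)/(6 Φ_B′(0)) (= −SE_B(0)/6)`. [folklore] -/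
theorem starBubbleMass_eq (B : Set ℂ) :
    starBubbleMass B = starJet2 B ^ 2 / (4 * starDeriv B ^ 2) - starJet3 B / (6 * starDeriv B) := by
  unfold starBubbleMass bubbleMass
  ring

/-- **The canonical map of the empty hull is the identity**: `starMap ∅ z = z` (`Φ_∅ = id` on
`ℍ` by uniqueness, reflected below the axis, and by boundary values on the axis). [folklore] -/
theorem starMap_empty_apply (z : ℂ) : starMap ∅ z = z := by
  have h := isStarHull_empty
  have hid : ∀ w : ℂ, 0 < w.im → (starRMap ∅ h) w = w := fun w hw ↦ by
    have := IsRestrictionMap.unique h (isRestrictionMap_starRMap h) isRestrictionMap_empty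
      ⟨hw, fun h ↦ h⟩
    rw [← this, restrictionMapEmpty_apply]
  rw [starMap_eq h]
  rcases lt_trichotomy z.im 0 with him | him | him
  · rw [hullExt_of_im_neg him, hid _ (by simpa using him), Complex.conj_conj]
  · -- a real point: the boundary value of `Φ_∅ = id`
    have hx : z = ((z.re : ℝ) : ℂ) := Complex.ext (by simp) (by simp [him])
    rw [hx]
    have hlim := tendsto_hullExt_ofReal h.isBoundedHull (isRestrictionMap_starRMap h)
      (x := z.re) (fun h ↦ h)
    have hlim' : Tendsto (starRMap ∅ h) (𝓝[upperHalfPlaneSet \ ∅] ((z.re : ℝ) : ℂ))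
        (𝓝 ((z.re : ℝ) : ℂ)) := by
      refine (tendsto_nhdsWithin_of_tendsto_nhds tendsto_id).congr' ?_
      filter_upwards [self_mem_nhdsWithin] with w hw
      exact (hid w hw.1).symm
    haveI : (𝓝[upperHalfPlaneSet \ ∅] ((z.re : ℝ) : ℂ)).NeBot := by
      refine mem_closure_iff_nhdsWithin_neBot.1 ?_
      rw [sdiff_empty, show upperHalfPlaneSet = {z : ℂ | 0 < z.im} from rfl, Complex.closure_setOf_lt_im]
      simp
    exact tendsto_nhds_unique hlim hlim'
  · rw [hullExt_of_im_pos him, hid _ him]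

/-- No hull, no mass: `starBubbleMass ∅ = 0` (`E_∅ = id`, so `E_∅″(0) = E_∅‴(0) = 0`). [folklore] -/
theorem starBubbleMass_empty : starBubbleMass (∅ : Set ℂ) = 0 := by
  have h := isStarHull_empty
  have hBρ : Disjoint (ball (0 : ℂ) (8 * 1)) (∅ : Set ℂ) := disjoint_empty _
  obtain ⟨e2, e3, -⟩ := starJet_spec h one_pos hBρ
  have hE : starMap ∅ = id := funext starMap_empty_apply
  have h1 : deriv (starMap ∅) = fun _ ↦ 1 := by
    rw [hE]
    funext z
    exact deriv_id z
  have h2 : deriv (deriv (starMap ∅)) =ᶠ[𝓝 0] fun _ ↦ 0 := by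
    refine Eventually.of_forall fun z ↦ ?_
    rw [h1]
    exact deriv_const z 1
  have hd2 : deriv (deriv (starMap ∅)) 0 = 0 := h2.eq_of_nhds
  have hd3 : deriv (deriv (deriv (starMap ∅))) 0 = 0 := by
    rw [h2.deriv_eq]
    exact deriv_const 0 0
  have hj2 : starJet2 ∅ = 0 := by
    have := e2.symm.trans hd2
    exact_mod_cast this
  have hj3 : starJet3 ∅ = 0 := by
    have := e3.symm.trans hd3
    exact_mod_cast this
  simp [starBubbleMass, hj2, hj3, bubbleMass]

/-- **Every `*`-hull has the canonical jet** `(Φ_B′(0), E_B″(0)/2, E_B‴(0)/6) =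
(starDeriv B, starJet2 B/2, starJet3 B/6)` at `0`. [cite: Lawler2005, proof of Prop. 5.22 (§5.5)] -/
theorem hasRestrictionJet_starRMap {B : Set ℂ} (h : IsStarHull B) :
    HasRestrictionJet B (starRMap B h) (starDeriv B) (starJet2 B / 2) (starJet3 B / 6) := by
  obtain ⟨r, hr0, hr⟩ := h.exists_disjoint_ball
  have hρ₀ : 0 < r / 4 := by positivity
  have hBρ : Disjoint (ball (0 : ℂ) (8 * (r / 4))) B := by
    rwa [show 8 * (r / 4) = 2 * r by ring]
  obtain ⟨e2, e3, -⟩ := starJet_spec h hρ₀ hBρ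
  have hJ := hasRestrictionJet_hullExt h (isRestrictionMap_starRMap h) (starDeriv_spec h).2.2 hρ₀ hBρ
  rw [← starMap_eq h, e2, e3] at hJ
  simpa only [ofReal_re] using hJ

/-- **(7.2) for a `*`-hull, with the canonical Schwarzian**: for every Brownian bubble measure `μ`
and every `B ∈ 𝒬*`, `μ{K : K ∩ B ≠ ∅} = −SΦ_B(0)/6 = starBubbleMass B`.
[cite: LawlerSchrammWerner2003Restriction, §7.1 eq. (7.2) (p. 28)] -/
theorem IsBrownianBubbleMeasure.measure_hit_eq_starBubbleMass {μ : Measure BubbleConfig}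
    (hμ : IsBrownianBubbleMeasure μ) {B : Set ℂ} (h : IsStarHull B) :
    μ (BubbleConfig.hit B) = ENNReal.ofReal (starBubbleMass B) :=
  hμ h (isRestrictionMap_starRMap h) (hasRestrictionJet_starRMap h)

/-! ### `{K : g_t⁻¹(K + W_t) ∩ A ≠ ∅} = {K : K ∩ (g_t(A) − W_t) ≠ ∅}` ([LSW] §7.2, first equality) -/

section Fibre

variable {κ : ℝ≥0} {ω : ℝ≥0 → ℝ} {A : Set ℂ} {t : ℝ≥0}

/-- **The bubbles whose attached copy hits `A` are the bubbles hitting the slid hull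
`A_t − W_t`** ([LSW] §7.2, p. 28: "`P[{K : g_t⁻¹(K + W_t) ∩ A ≠ ∅} | g_t] =
P[{K : (K + W_t) ∩ g_t(A) ≠ ∅} | g_t]`"), provided no point of `A ⊆ ℍ̄` is swallowed by time
`t`: `g_t⁻¹` is the inverse of `g_t : H_t → ℍ` and a bubble lies in the open half-plane, while
the real points of `A` are sent by `g_t − W_t` to real points, off every bubble
(`Loewner.map_ofReal_im`). [cite: LawlerSchrammWerner2003Restriction, §7.2 (p. 28, proof of (7.3), first display)] -/
theorem bubbleHitFibre_eq_hit_slidHull (hAim : ∀ a ∈ A, 0 ≤ a.im)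
    (hflow : ∀ a ∈ A, (t : WithTop ℝ≥0) < swallowingTime (sleDriving κ ω) a) :
    bubbleHitFibre κ ω A t = BubbleConfig.hit (slidHull (sleDriving κ ω) A t) := by
  have hW := continuous_sleDriving κ ω
  set W := sleDriving κ ω with hWdef
  ext K
  rw [mem_bubbleHitFibre_iff, attachedBubble_eq_image_fHat, BubbleConfig.hit, mem_setOf_eq,
    Set.not_disjoint_iff, Set.not_disjoint_iff]
  constructor
  · rintro ⟨_, ⟨z, hzK, rfl⟩, hzA⟩
    -- `a = f_t(z + W_t) ∈ A`, and `g_t(a) − W_t = z ∈ K`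
    have hzim : 0 < ((W t : ℂ) + z).im := by simpa using K.subset_upperHalfPlaneSet hzK
    refine ⟨z, hzK, (mem_slidHull_iff).2 ⟨_, hzA, ?_⟩⟩
    rw [fHat_apply, map_loewnerInv hW t hzim]
    ring
  · rintro ⟨k, hkK, hkB⟩
    obtain ⟨a, haA, rfl⟩ := (mem_slidHull_iff).1 hkB
    have hkim : 0 < (map W t a - W t).im := K.subset_upperHalfPlaneSet hkK
    -- `a` is not real (real points go to real points), hence `a ∈ H_t`
    have haim : 0 < a.im := by
      rcases (hAim a haA).lt_or_eq with h | h
      · exact h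
      · exfalso
        have ha : a = ((a.re : ℝ) : ℂ) := Complex.ext (by simp) (by simp [← h])
        have hreal : (map W t a).im = 0 := by
          rw [ha]
          exact map_ofReal_im hW (by simpa [← ha] using hflow a haA)
        rw [sub_im, hreal, ofReal_im, sub_zero] at hkim
        exact lt_irrefl _ hkim
    have hadom : a ∈ domain W t := (mem_domain_iff W t a).2 ⟨haim, hflow a haA⟩
    refine ⟨_, ⟨map W t a - W t, hkK, rfl⟩, ?_⟩
    rw [fHat_apply, show (W t : ℂ) + (map W t a - W t) = map W t a by ring, loewnerInv_map hW hadom]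
    exact haA

/-- **Along a simple curve missing `A`, at every time**: if the SLE_κ chain of the sample `ω`
is generated by a simple curve with `γ[0, ∞) ∩ A = ∅`, `A ∈ 𝒬`, then for every `t` no point
of `A` is swallowed (`Loewner.IsGeneratedByCurve.lt_swallowingTime_of_disjoint`) and
`{K : g_t⁻¹(K + W_t) ∩ A ≠ ∅} = {K : K ∩ (A_t − W_t) ≠ ∅}`. [cite: LawlerSchrammWerner2003Restriction, §7.2 (p. 28, proof of (7.3), first display)] -/
theorem bubbleHitFibre_eq_hit_slidHull_of_disjoint (hs : IsSimpleTrace (sleTrace κ ω))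
    (hA : IsBoundedHull A) (hdisj : Disjoint (range (sleTrace κ ω)) A) (t : ℝ≥0) :
    bubbleHitFibre κ ω A t = BubbleConfig.hit (slidHull (sleDriving κ ω) A t) := by
  have hgen := isGeneratedByCurve_sleTrace_of_isSimpleTrace hs
  have hAim : ∀ a ∈ A, 0 ≤ a.im := fun a ha ↦ by
    have := hA.subset_closure ha
    rwa [show upperHalfPlaneSet = {z : ℂ | 0 < z.im} from rfl, Complex.closure_setOf_lt_im] at this
  refine bubbleHitFibre_eq_hit_slidHull hAim fun a ha ↦ ?_
  exact hgen.lt_swallowingTime_of_disjoint (continuous_sleDriving κ ω) hs hA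
    (hdisj.mono_left (image_subset_range _ _)) ha

/-- **The slid hull of a `*`-hull along a simple curve missing it is a `*`-hull, at every time**
(`Loewner.IsGeneratedByCurve.isStarHull_slidHull` along the SLE_κ sample).
[cite: LawlerSchrammWerner2003Restriction, §5 (A_t = g_t(A) ∈ 𝒬*)] -/
theorem isStarHull_slidHull_of_disjoint (hs : IsSimpleTrace (sleTrace κ ω)) (hA : IsStarHull A)
    (hdisj : Disjoint (range (sleTrace κ ω)) A) (t : ℝ≥0) :
    IsStarHull (slidHull (sleDriving κ ω) A t) :=
  (isGeneratedByCurve_sleTrace_of_isSimpleTrace hs).isStarHull_slidHull (continuous_sleDriving κ ω)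
    (sleDriving_zero κ ω) hs hA (isRestrictionMap_starRMap hA) (hdisj.mono_left (image_subset_range _ _))

/-- **(7.2) for the slid hulls** ([LSW] §7.2, p. 28, the display of the proof of (7.3)):
`μ{K : g_t⁻¹(K + W_t) ∩ A ≠ ∅} = −Sh_t(W_t)/6 = starBubbleMass (A_t − W_t)` for every Brownian
bubble measure `μ`, every `A ∈ 𝒬*`, every sample whose chain is generated by a simple curve
missing `A`, and every `t`. [cite: LawlerSchrammWerner2003Restriction, §7.2 (pp. 28–29, proof of (7.3)) with eq. (7.2)] -/
theorem IsBrownianBubbleMeasure.measure_bubbleHitFibre_eq {μ : Measure BubbleConfig}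
    (hμ : IsBrownianBubbleMeasure μ) (hs : IsSimpleTrace (sleTrace κ ω)) (hA : IsStarHull A)
    (hdisj : Disjoint (range (sleTrace κ ω)) A) (t : ℝ≥0) :
    μ (bubbleHitFibre κ ω A t) = ENNReal.ofReal (starBubbleMass (slidHull (sleDriving κ ω) A t)) := by
  rw [bubbleHitFibre_eq_hit_slidHull_of_disjoint hs hA.isBoundedHull hdisj t,
    hμ.measure_hit_eq_starBubbleMass (isStarHull_slidHull_of_disjoint hs hA hdisj t)]

end Fibre

/-! ### The named fact from Theorem 6.5 as printed -/

/-- **`SLEBubbles.lintegral_poissonAvoidance_eq_rpow` from [LSW] Theorem 6.5 as printed.**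
Hypothesis `h65`: for `0 < κ ≤ 8/3`, `A ∈ 𝒬*` with restriction map `Φ` and `Φ′(0) = d`,
`E[1_{γ[0,∞) ∩ A = ∅} exp(−λ_κ ∫₀^∞ (−Sh_t(W_t)/6) dt)] = d^{α_κ}`, the Schwarzian term written
as `starBubbleMass (A_t − W_t)` (the canonical map of the slid hull IS `h_t(· + W_t) − h_t(W_t)`),
`exp(−∞) = 0`. Conclusion: the same with `−Sh_t(W_t)/6` replaced by
`μ{K : g_t⁻¹(K + W_t) ∩ A ≠ ∅}` for an arbitrary Brownian bubble measure `μ`, i.e. the named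
fact — because for `preWienerMeasure`-a.e. sample the trace is a simple curve (Rohde–Schramm,
`κ ≤ 4`), and then on `{γ ∩ A = ∅}` the two integrands agree at every `t`
(`IsBrownianBubbleMeasure.measure_bubbleHitFibre_eq`). [cite: LawlerSchrammWerner2003Restriction, Thm. 6.5 (§6) with §7.2 (pp. 28–29, proof of (7.3))] -/
theorem SLEBubbles.lintegral_poissonAvoidance_eq_rpow_of_thm65
    (h65 : ∀ {κ : ℝ≥0}, 0 < κ → κ ≤ 8 / 3 → ∀ {A : Set ℂ}, IsStarHull A →
      ∀ {Φ : ConformalEquiv (upperHalfPlaneSet \ A) upperHalfPlaneSet}, IsRestrictionMap A Φ →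
        ∀ {d : ℝ}, HasRestrictionDeriv A Φ d →
          ∫⁻ ω, {ω | Disjoint (range (sleTrace κ ω)) A}.indicator
              (fun ω ↦ poissonAvoidance (sleBubbleIntensity κ *
                ∫⁻ t, ENNReal.ofReal (starBubbleMass (slidHull (sleDriving κ ω) A t)) ∂timeMeasure)) ω
            ∂preWienerMeasure = ENNReal.ofReal (d ^ sleBubbleExponent κ)) :
    SLEBubbles.lintegral_poissonAvoidance_eq_rpow := by
  intro κ hκ0 hκ μ hμ A hA Φ hΦ d hd
  rw [← h65 hκ0 hκ hA hΦ hd]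
  refine lintegral_congr_ae ?_
  filter_upwards [SLEBubbles.ae_isSimpleTrace_sleTrace κ hκ0 (SLEBubbles.le_four_of_le hκ)] with ω hs
  by_cases hdisj : Disjoint (range (sleTrace κ ω)) A
  · rw [indicator_of_mem (show ω ∈ {ω | Disjoint (range (sleTrace κ ω)) A} from hdisj),
      indicator_of_mem (show ω ∈ {ω | Disjoint (range (sleTrace κ ω)) A} from hdisj)]
    congr 2
    refine lintegral_congr fun t ↦ ?_
    exact hμ.measure_bubbleHitFibre_eq hs hA hdisj t
  · rw [indicator_of_notMem (show ω ∉ {ω | Disjoint (range (sleTrace κ ω)) A} from hdisj),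
      indicator_of_notMem (show ω ∉ {ω | Disjoint (range (sleTrace κ ω)) A} from hdisj)]

/-! ### Sanity checks of the printed form: the empty hull, and `κ = 8/3` (Theorem 6.1) -/

/-- **Theorem 6.5 in the printed form is consistent at `A = ∅`** (`Φ_∅ = id`, `Φ_∅′(0) = 1`,
no Schwarzian mass along the flow): both sides equal `1`, for every `κ`. [folklore] -/
theorem SLEBubbles.thm65_schwarzian_empty (κ : ℝ≥0) :
    ∫⁻ ω, {ω | Disjoint (range (sleTrace κ ω)) (∅ : Set ℂ)}.indicator
        (fun ω ↦ poissonAvoidance (sleBubbleIntensity κ *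
          ∫⁻ t, ENNReal.ofReal (starBubbleMass (slidHull (sleDriving κ ω) ∅ t)) ∂timeMeasure)) ω
      ∂preWienerMeasure = ENNReal.ofReal ((1 : ℝ) ^ sleBubbleExponent κ) := by
  haveI : IsProbabilityMeasure preWienerMeasure := isProbabilityMeasure_preWienerMeasure'
  simp [starBubbleMass_empty]

/-- `λ_{8/3} = 0` ([LSW] p. 29: "while `λ_{8/3} = 0`"). [cite: LawlerSchrammWerner2003Restriction, §7.2 (p. 29)] -/
theorem sleBubbleIntensity_eight_thirds : sleBubbleIntensity ((8 : ℝ≥0) / 3) = 0 := by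
  rw [sleBubbleIntensity, sleBubbleIntensityReal]
  push_cast
  norm_num

/-- `α_{8/3} = 5/8` ([LSW] p. 29). [cite: LawlerSchrammWerner2003Restriction, §7.2 (p. 29)] -/
theorem sleBubbleExponent_eight_thirds : sleBubbleExponent ((8 : ℝ≥0) / 3) = 5 / 8 := by
  rw [sleBubbleExponent]
  push_cast
  norm_num

/-- **Theorem 6.5 in the printed form holds at `κ = 8/3`: it is [LSW] Theorem 6.1**
(`sle_restriction_eightThirds_holds`): `λ_{8/3} = 0`, so the functional is the indicator of
`{γ ∩ A = ∅}` (a null-measurable event, `nullMeasurableSet_disjoint_range` with the a.e.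
measurability of the trace marginals), and `α_{8/3} = 5/8`.
[cite: LawlerSchrammWerner2003Restriction, Thm. 6.5 (§6) at κ = 8/3, i.e. Thm. 6.1 (p. 23)] -/
theorem SLEBubbles.thm65_schwarzian_eight_thirds {A : Set ℂ} (hA : IsStarHull A)
    {Φ : ConformalEquiv (upperHalfPlaneSet \ A) upperHalfPlaneSet} (hΦ : IsRestrictionMap A Φ)
    {d : ℝ} (hd : HasRestrictionDeriv A Φ d) :
    ∫⁻ ω, {ω | Disjoint (range (sleTrace ((8 : ℝ≥0) / 3) ω)) A}.indicator
        (fun ω ↦ poissonAvoidance (sleBubbleIntensity ((8 : ℝ≥0) / 3) *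
          ∫⁻ t, ENNReal.ofReal (starBubbleMass (slidHull (sleDriving ((8 : ℝ≥0) / 3) ω) A t))
            ∂timeMeasure)) ω
      ∂preWienerMeasure = ENNReal.ofReal (d ^ sleBubbleExponent ((8 : ℝ≥0) / 3)) := by
  have hnull : NullMeasurableSet {ω | Disjoint (range (sleTrace ((8 : ℝ≥0) / 3) ω)) A}
      preWienerMeasure :=
    nullMeasurableSet_disjoint_range (fun ω ↦ continuous_sleTrace _ ω)
      (fun t ↦ aemeasurable_sleTrace_holds hasSLETrace_eightThirds t) hA.isBoundedHull.isClosed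
  simp_rw [sleBubbleIntensity_eight_thirds, zero_mul, poissonAvoidance_zero]
  rw [sleBubbleExponent_eight_thirds, ← sle_restriction_eightThirds_holds hA hΦ hd,
    ← lintegral_indicator_one₀ hnull]
  rfl

/-! ### [LSW] Prop. 5.3: the drift of `h_t′(W_t)^α` is `λ_κ · (−Sh_t(W_t)/6) · h_t′(W_t)^α` at `α = α_κ` -/

/-- **The drift per unit time of `Y = d^α` under the one-step expansion** of `StarHullOneStep`
(`d′ − d = c₂ x + c₃ x²/2 + u (c₂²/(2d) − (4/3) c₃) + …`, `E x = 0`, `E x² = κ u`; `c₂ = E″(0)`,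
`c₃ = E‴(0)`): with `f(y) = y^α`,
`f′(d) [(κ/2) c₃ + c₂²/(2d) − (4/3) c₃] + ½ f″(d) κ c₂²` — the `dt`-coefficient of `d(h_t′(W_t)^α)`
in [LSW] (5.3) (Lawler (4.37) for `∂_t h_t′(W_t)`). `driftCoeff` of `StarHullOneStep` is the case
`α = 5/8`. [cite: LawlerSchrammWerner2003Restriction, §5 (5.3) and Prop. 5.3] -/
def driftCoeffK (κ α d c₂ c₃ : ℝ) : ℝ :=
  α * d ^ (α - 1) * (κ / 2 * c₃ + c₂ ^ 2 / (2 * d) - 4 / 3 * c₃) +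
    1 / 2 * (α * (α - 1) * d ^ (α - 2)) * κ * c₂ ^ 2

/-- `driftCoeffK κ (5/8) = driftCoeff κ` (`StarHullOneStep`). [folklore] -/
theorem driftCoeffK_five_eighths (κ d c₂ c₃ : ℝ) :
    driftCoeffK κ (5 / 8) d c₂ c₃ = driftCoeff κ d c₂ c₃ := by
  unfold driftCoeffK driftCoeff
  rw [show (5 / 8 : ℝ) - 1 = -(3 / 8) by norm_num, show (5 / 8 : ℝ) - 2 = -(11 / 8) by norm_num]
  ring

/-- **[LSW] Prop. 5.3, the computation**: for `κ > 0`, `d > 0` and `α = α_κ = (6 − κ)/(2κ)`,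
the drift of `d^α` equals `λ_κ · (−SΦ(0)/6) · d^α` with `λ_κ = (8 − 3κ)(6 − κ)/(2κ)` and
`−SΦ(0)/6 = bubbleMass d (c₂/2) (c₃/6) = c₂²/(4d²) − c₃/(6d)`; hence
`Y_t = h_t′(W_t)^α exp(λ ∫₀ᵗ Sh_s(W_s)/6 ds)` has no drift ("is a local martingale"). The two
coefficient identities are `α(κ/2 − 4/3) = −λ/6` and `α/2 + α(α − 1)κ/2 = λ/4`.
[cite: LawlerSchrammWerner2003Restriction, Prop. 5.3 with (5.2)–(5.3)] -/
theorem driftCoeffK_sleBubbleExponent {κ d : ℝ} (hκ : 0 < κ) (hd : 0 < d) (c₂ c₃ : ℝ) :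
    driftCoeffK κ ((6 - κ) / (2 * κ)) d c₂ c₃ =
      (8 - 3 * κ) * (6 - κ) / (2 * κ) * bubbleMass d (c₂ / 2) (c₃ / 6) * d ^ ((6 - κ) / (2 * κ)) := by
  unfold driftCoeffK bubbleMass
  set α : ℝ := (6 - κ) / (2 * κ) with hα
  have h1 : d ^ (α - 1) = d ^ α / d := Real.rpow_sub_one hd.ne' α
  have h2 : d ^ (α - 2) = d ^ α / d ^ 2 := by
    rw [Real.rpow_sub hd, Real.rpow_two]
  rw [h1, h2, hα]
  field_simp
  ring

/-- The same identity with the tree's names `sleBubbleExponent κ = (6 − κ)/(2κ)` and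
`sleBubbleIntensityReal κ = (8 − 3κ)(6 − κ)/(2κ)` (`SLEBubbles`), for `κ : ℝ≥0`.
[cite: LawlerSchrammWerner2003Restriction, Prop. 5.3 with (5.2)–(5.3)] -/
theorem driftCoeffK_sleBubbleExponent' {κ : ℝ≥0} (hκ : 0 < κ) {d : ℝ} (hd : 0 < d) (c₂ c₃ : ℝ) :
    driftCoeffK κ (sleBubbleExponent κ) d c₂ c₃ =
      sleBubbleIntensityReal κ * bubbleMass d (c₂ / 2) (c₃ / 6) * d ^ sleBubbleExponent κ := by
  have hκ' : (0 : ℝ) < κ := by exact_mod_cast hκ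
  rw [sleBubbleExponent, sleBubbleIntensityReal, driftCoeffK_sleBubbleExponent hκ' hd]

/-- **At `κ = 8/3` there is nothing to compensate**: `λ_{8/3} = 0`, and the drift of `d^{5/8}`
vanishes (`StarHullOneStep.driftCoeff_eight_thirds`, [LSW] Prop. 5.2). [cite: LawlerSchrammWerner2003Restriction, Prop. 5.2] -/
theorem driftCoeffK_eight_thirds {d : ℝ} (hd : 0 < d) (c₂ c₃ : ℝ) :
    driftCoeffK (8 / 3) (5 / 8) d c₂ c₃ = 0 := by
  rw [driftCoeffK_five_eighths, driftCoeff_eight_thirds hd]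

end Literature.Probability.RandomPlanarGeometry

end
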